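import Summits.CriticalPhenomena.CardyFormulaZ2.Theorems.CardyIKTransportIKMixedBoxCrossingTransportStubLinkArcsIffAux
import Summits.CriticalPhenomena.CardyFormulaZ2.Theorems.CardyIKTransportIKMixedBoxCrossingTransportStubSlabDeterminacy

/-!
# Stub `stub_linkArcsIff` (H1 of the link decomposition), AUXILIARY FILE 2 — the wider slab and the direction
# "link function ⇒ arcs event"
# (line `defect-closure-exploration`, reshape v5b, crux `IKMixedBoxCrossing`, stmt-CriticalPhenomena-5911)

Support file (`--supports stmt-CriticalPhenomena-5911`).  Vocabulary: `…TransportLinkDefs` (necklaces, `cross`,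
`crossVec`, `runCells`, `RunMeets`, `Linked`, `Phi`), bookkeeping `…TransportStubLinkArcsIffAux`.

* §2 THE EXTENDED CONFIGURATION `(splitEquiv w L).symm (y, (c, f))` of the slab with one more face
  column: its colours and flags (`ext_fst_castSucc`, `ext_fst_last`, `ext_snd_castSucc`, `ext_snd_last`),
  black paths of `y` lift (`blackConn_lift`, from `CylBunchStub.blackConn_resLE`), between two old columns its
  triangulation is that of `y` (`adj_castSucc_iff`, from `SlabDetStub.adj_shift`), and its edges with the new cell
  column are: horizontal / main diagonal (flag `false`) / anti-diagonal (flag `true`) from the last old column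
  (`adj_castSucc_last_iff`) and vertical inside it (`adj_last_last_iff`); closure properties of `BlackConn`.
* §3 "⇐": every run is vertically connected (`run_conn`), a CROSSED gap joins the top cell of its run to the bottom
  cell of the next run through the new column (`gap_conn`), so a chain of links is a black path of the wider slab
  (`chain_conn`), and `N.Phi y n (N.crossVec c f)` gives the arcs event (`stub_linkArcsIff_of_phi`).
-/

noncomputable section

namespace Summit.CriticalPhenomena.CardyFormulaZ2.Cruxes.IKMixedBoxCrossing.DefectClosureExploration

open scoped Classical
open CylBunchStub (splitEquiv resLE blackConn_resLE)

namespace LinkArcsIffStub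

variable {L : ℕ} (N : Necklace L)

/-! ## §2 The extended configuration and the triangulation of the wider slab -/

variable {w : ℕ} (y : CylCfg w L) (c f : ZMod L → Bool)

/-- Old cell columns carry the colours of `y`. -/
@[simp] theorem ext_fst_castSucc (i : Fin (w + 1)) (r : ZMod L) :
    ((splitEquiv w L).symm (y, (c, f))).1 (i.castSucc, r) = y.1 (i, r) := by
  simp [splitEquiv]

/-- The new cell column carries `c`. -/
@[simp] theorem ext_fst_last (r : ZMod L) : ((splitEquiv w L).symm (y, (c, f))).1 (Fin.last (w + 1), r) = c r := by
  simp [splitEquiv]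

/-- Old face columns carry the flags of `y`. -/
@[simp] theorem ext_snd_castSucc (j : Fin w) (r : ZMod L) :
    ((splitEquiv w L).symm (y, (c, f))).2 (j.castSucc, r) = y.2 (j, r) := by
  simp [splitEquiv]

/-- The new face column carries `f`. -/
@[simp] theorem ext_snd_last (r : ZMod L) : ((splitEquiv w L).symm (y, (c, f))).2 (Fin.last w, r) = f r := by
  simp [splitEquiv]

/-- Restricting the wider configuration to the interior gives back `y`. -/
theorem resLE_ext : resLE (Nat.le_succ w) ((splitEquiv w L).symm (y, (c, f))) = y := by
  show ((splitEquiv w L) ((splitEquiv w L).symm (y, (c, f)))).1 = y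
  rw [Equiv.apply_symm_apply]

variable {y c f}

/-- Black paths of the interior are black paths of the wider slab. -/
theorem blackConn_lift {u v : Fin (w + 1) × ZMod L} (h : BlackConn y u v) :
    BlackConn ((splitEquiv w L).symm (y, (c, f))) (u.1.castSucc, u.2) (v.1.castSucc, v.2) := by
  have key := blackConn_resLE (Nat.le_succ w) ((splitEquiv w L).symm (y, (c, f))) u v (by rw [resLE_ext]; exact h)
  exact key

/-- Between old columns the triangulation of the wider slab is the triangulation of the interior. -/
theorem adj_castSucc_iff (a b : Fin (w + 1) × ZMod L) :
    (cylGraph (w + 1) L ((splitEquiv w L).symm (y, (c, f))).2).Adj (a.1.castSucc, a.2) (b.1.castSucc, b.2) ↔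
      (cylGraph w L y.2).Adj a b :=
  SlabDetStub.adj_shift (i := 0) (flg := ((splitEquiv w L).symm (y, (c, f))).2) (flg' := y.2)
    (fun j r h => by
      have hj : (⟨0 + j.val, h⟩ : Fin (w + 1)) = j.castSucc := Fin.ext (by simp)
      rw [hj, ext_snd_castSucc])
    (by simp) rfl (by simp) rfl

/-- Edges between an old column and the new column: only from the last old column, horizontal, main diagonal
(flag `false`) or anti-diagonal (flag `true`). -/
theorem adj_castSucc_last_iff (i : Fin (w + 1)) (r s : ZMod L) :
    (cylGraph (w + 1) L ((splitEquiv w L).symm (y, (c, f))).2).Adj (i.castSucc, r) (Fin.last (w + 1), s) ↔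
      i = Fin.last w ∧ (s = r ∨ (s = r + 1 ∧ f r = false) ∨ (r = s + 1 ∧ f s = true)) := by
  simp only [cylGraph, SimpleGraph.fromRel_adj]
  constructor
  · rintro ⟨-, h⟩
    rcases h with (⟨h1, -⟩ | ⟨h1, h2⟩ | ⟨j, h1, h2, h3, h4⟩ | ⟨j, h1, h2, h3, h4⟩) |
      (⟨h1, -⟩ | ⟨h1, -⟩ | ⟨j, h1, -⟩ | ⟨j, h1, -⟩)
    · exact absurd h1.symm (Fin.castSucc_ne_last i)
    · refine ⟨Fin.ext ?_, Or.inl h2⟩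
      simp only [Fin.val_last, Fin.val_castSucc] at h1 ⊢
      omega
    · have hj : j = Fin.last w := by rw [← Fin.succ_last] at h2; exact (Fin.succ_inj.1 h2).symm
      subst hj
      exact ⟨Fin.castSucc_inj.1 h1, Or.inr (Or.inl ⟨h3, by simpa using h4⟩)⟩
    · have hj : j = Fin.last w := by rw [← Fin.succ_last] at h2; exact (Fin.succ_inj.1 h2).symm
      subst hj
      exact ⟨Fin.castSucc_inj.1 h1, Or.inr (Or.inr ⟨h3, by simpa using h4⟩)⟩
    · exact absurd h1 (Fin.castSucc_ne_last i)
    · simp only [Fin.val_last, Fin.val_castSucc] at h1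
      have := i.isLt
      omega
    · exact absurd h1.symm (Fin.castSucc_ne_last j)
    · exact absurd h1.symm (Fin.castSucc_ne_last j)
  · rintro ⟨rfl, h⟩
    refine ⟨fun heq => Fin.castSucc_ne_last _ (congrArg Prod.fst heq), Or.inl ?_⟩
    rcases h with rfl | ⟨rfl, hf⟩ | ⟨rfl, hf⟩
    · exact Or.inr (Or.inl ⟨by simp, rfl⟩)
    · exact Or.inr (Or.inr (Or.inl ⟨Fin.last w, rfl, (Fin.succ_last _).symm, rfl, by simpa using hf⟩))
    · exact Or.inr (Or.inr (Or.inr ⟨Fin.last w, rfl, (Fin.succ_last _).symm, rfl, by simpa using hf⟩))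

/-- Edges inside the new column are vertical. -/
theorem adj_last_last_iff (r s : ZMod L) :
    (cylGraph (w + 1) L ((splitEquiv w L).symm (y, (c, f))).2).Adj (Fin.last (w + 1), r) (Fin.last (w + 1), s) ↔
      r ≠ s ∧ (s = r + 1 ∨ r = s + 1) := by
  simp only [cylGraph, SimpleGraph.fromRel_adj]
  constructor
  · rintro ⟨hne, h⟩
    refine ⟨fun hrs => hne (by rw [hrs]), ?_⟩
    rcases h with (⟨-, h2⟩ | ⟨h1, -⟩ | ⟨j, h1, -⟩ | ⟨j, h1, -⟩) |
      (⟨-, h2⟩ | ⟨h1, -⟩ | ⟨j, h1, -⟩ | ⟨j, h1, -⟩)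
    · exact Or.inl h2
    · simp at h1
    · exact absurd h1.symm (Fin.castSucc_ne_last j)
    · exact absurd h1.symm (Fin.castSucc_ne_last j)
    · exact Or.inr h2
    · simp at h1
    · exact absurd h1.symm (Fin.castSucc_ne_last j)
    · exact absurd h1.symm (Fin.castSucc_ne_last j)
  · rintro ⟨hne, h⟩
    refine ⟨fun heq => hne (congrArg Prod.snd heq), ?_⟩
    rcases h with h | h
    · exact Or.inl (Or.inl ⟨trivial, h⟩)
    · exact Or.inr (Or.inl ⟨trivial, h⟩)

/-- Vertical edges of the triangulation (any slab, any column). -/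
theorem adj_vertical {w' : ℕ} (flg : Fin w' × ZMod L → Bool) (j : Fin (w' + 1)) {r s : ZMod L} (hne : r ≠ s)
    (h : s = r + 1) : (cylGraph w' L flg).Adj (j, r) (j, s) := by
  rw [cylGraph, SimpleGraph.fromRel_adj]
  exact ⟨fun heq => hne (congrArg Prod.snd heq), Or.inl (Or.inl ⟨rfl, h⟩)⟩

/-! ### Black connectivity: elementary closure properties -/

section blackConn

variable {w' : ℕ} {x : CylCfg w' L}

/-- A black cell is connected to itself. -/
theorem blackConn_refl {u : Fin (w' + 1) × ZMod L} (hu : x.1 u = true) : BlackConn x u u :=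
  ⟨hu, hu, SimpleGraph.Reachable.refl _⟩

/-- Symmetry. -/
theorem blackConn_symm {u v : Fin (w' + 1) × ZMod L} (h : BlackConn x u v) : BlackConn x v u := by
  obtain ⟨hu, hv, hr⟩ := h
  exact ⟨hv, hu, hr.symm⟩

/-- Transitivity. -/
theorem blackConn_trans {u v z : Fin (w' + 1) × ZMod L} (h1 : BlackConn x u v) (h2 : BlackConn x v z) :
    BlackConn x u z := by
  obtain ⟨hu, _, hr⟩ := h1
  obtain ⟨_, hz, hr'⟩ := h2
  exact ⟨hu, hz, hr.trans hr'⟩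

/-- A black edge. -/
theorem blackConn_adj {u v : Fin (w' + 1) × ZMod L} (hu : x.1 u = true) (hv : x.1 v = true)
    (h : (cylGraph w' L x.2).Adj u v) : BlackConn x u v :=
  ⟨hu, hv, SimpleGraph.Adj.reachable (show ((cylGraph w' L x.2).induce {z | x.1 z = true}).Adj ⟨u, hu⟩ ⟨v, hv⟩ from h)⟩

/-- Extending a black path by a black edge. -/
theorem blackConn_step {u v z : Fin (w' + 1) × ZMod L} (h : BlackConn x u v) (hz : x.1 z = true)
    (ha : (cylGraph w' L x.2).Adj v z) : BlackConn x u z :=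
  blackConn_trans h (blackConn_adj h.2.1 hz ha)

/-- A black path yields a chain of black edges (for inductions along paths). -/
theorem rtg_of_blackConn {u v : Fin (w' + 1) × ZMod L} (h : BlackConn x u v) :
    Relation.ReflTransGen (fun a b => x.1 a = true ∧ x.1 b = true ∧ (cylGraph w' L x.2).Adj a b) u v := by
  obtain ⟨hu, hv, hr⟩ := h
  rw [SimpleGraph.reachable_iff_reflTransGen] at hr
  have key : ∀ a b : {z | x.1 z = true},
      Relation.ReflTransGen ((cylGraph w' L x.2).induce {z | x.1 z = true}).Adj a b →
        Relation.ReflTransGen (fun p q => x.1 p = true ∧ x.1 q = true ∧ (cylGraph w' L x.2).Adj p q) a.1 b.1 := by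
    intro a b hab
    induction hab with
    | refl => exact Relation.ReflTransGen.refl
    | @tail p q _ hpq ih => exact ih.tail ⟨p.2, q.2, hpq⟩
  exact key ⟨u, hu⟩ ⟨v, hv⟩ hr

/-- A vertical segment of black cells at consecutive offsets is connected. -/
theorem vert_conn (j : Fin (w' + 1)) (o : ℕ) :
    ∀ d : ℕ, (∀ t, o ≤ t → t ≤ o + d → x.1 (j, N.row t) = true) →
      BlackConn x (j, N.row o) (j, N.row (o + d))
  | 0, h => by simpa using blackConn_refl (h o le_rfl (by omega))
  | d + 1, h => by
    have ih := vert_conn j o d (fun t h1 h2 => h t h1 (by omega))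
    refine blackConn_step ih (h (o + (d + 1)) (by omega) le_rfl) ?_
    rw [← add_assoc]
    exact adj_vertical x.2 j (row_succ_ne N (o + d)).symm (row_succ N (o + d))

end blackConn

/-! ## §3 "⇐": the link function forces the arcs event -/

section phiToArcs

variable (hcol : N.col = fun r => y.1 (Fin.last w, r))
include hcol

/-- Run cells are black in the wider slab. -/
theorem ext_black_of_inRun {i : Fin N.k} {o : ℕ} (h : N.InRun i o) :
    ((splitEquiv w L).symm (y, (c, f))).1 ((Fin.last w).castSucc, N.row o) = true := by
  rw [ext_fst_castSucc, ← show N.col (N.row o) = y.1 (Fin.last w, N.row o) from congrFun hcol _]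
  exact col_row_of_inRun N h

/-- Every run is vertically connected in the wider slab. -/
theorem run_conn {i : Fin N.k} {o o' : ℕ} (ho : N.InRun i o) (ho' : N.InRun i o') :
    BlackConn ((splitEquiv w L).symm (y, (c, f))) ((Fin.last w).castSucc, N.row o)
      ((Fin.last w).castSucc, N.row o') := by
  have key : ∀ {p q : ℕ}, N.InRun i p → N.InRun i q → p ≤ q →
      BlackConn ((splitEquiv w L).symm (y, (c, f))) ((Fin.last w).castSucc, N.row p)
        ((Fin.last w).castSucc, N.row q) := by
    intro p q hp hq hpq
    obtain ⟨d, rfl⟩ := Nat.exists_eq_add_of_le hpq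
    refine vert_conn N _ p d fun t h1 h2 => ext_black_of_inRun N hcol (i := i) ?_
    unfold Necklace.InRun at *
    omega
  rcases le_total o o' with h | h
  · exact key ho ho' h
  · exact blackConn_symm (key ho' ho h)

/-- A CROSSED GAP joins the top cell of its run to the bottom cell of the next run through the new column. -/
theorem gap_conn {i : Fin N.k} (hx : N.cross c f i = true) :
    BlackConn ((splitEquiv w L).symm (y, (c, f))) ((Fin.last w).castSucc, N.row (N.gapStart i - 1))
      ((Fin.last w).castSucc, N.row (N.gapStart i + N.gapLen i)) := by
  rw [cross_eq_true_iff] at hx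
  obtain ⟨hall, hbot, htop⟩ := hx
  have hg := N.gap_pos i
  have ha : 1 ≤ N.gapStart i := by have := N.run_pos i; unfold Necklace.gapStart; omega
  set a := N.gapStart i with ha_def
  set g := N.gapLen i with hg_def
  have hgap : ∀ t, a ≤ t → t < a + g →
      ((splitEquiv w L).symm (y, (c, f))).1 (Fin.last (w + 1), N.row t) = true := fun t h1 h2 => by
    rw [ext_fst_last]; exact hall t ⟨h1, h2⟩
  have hlo : ((splitEquiv w L).symm (y, (c, f))).1 ((Fin.last w).castSucc, N.row (a - 1)) = true :=
    ext_black_of_inRun N hcol (inRun_gapStart_sub_one N i)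
  have hhi : ((splitEquiv w L).symm (y, (c, f))).1 ((Fin.last w).castSucc, N.row (a + g)) = true := by
    rw [ha_def, hg_def, row_gapEnd N i ⟨(i.val + 1) % N.k, Nat.mod_lt _ N.hk⟩ rfl]
    exact ext_black_of_inRun N hcol (inRun_runStart N _)
  have hrow : N.row (a - 1) + 1 = N.row a := by rw [← row_succ, Nat.sub_add_cancel ha]
  have hrow' : N.row (a + g - 1) + 1 = N.row (a + g) := by rw [← row_succ, Nat.sub_add_cancel (by omega)]
  -- middle: the gap cells of the new column
  have hmid : BlackConn ((splitEquiv w L).symm (y, (c, f))) (Fin.last (w + 1), N.row a)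
      (Fin.last (w + 1), N.row (a + (g - 1))) :=
    vert_conn N _ a (g - 1) fun t h1 h2 => hgap t h1 (by omega)
  rw [show a + (g - 1) = a + g - 1 by omega] at hmid
  -- bottom attachment
  have hbot' : BlackConn ((splitEquiv w L).symm (y, (c, f))) ((Fin.last w).castSucc, N.row (a - 1))
      (Fin.last (w + 1), N.row a) := by
    rcases hbot with hc | hf
    · have h1 : BlackConn ((splitEquiv w L).symm (y, (c, f))) ((Fin.last w).castSucc, N.row (a - 1))
          (Fin.last (w + 1), N.row (a - 1)) :=
        blackConn_adj hlo (by rw [ext_fst_last]; exact hc) ((adj_castSucc_last_iff _ _ _).2 ⟨rfl, Or.inl rfl⟩)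
      exact blackConn_step h1 (hgap a le_rfl (by omega))
        ((adj_last_last_iff _ _).2 ⟨by rw [← hrow, ← row_succ]; exact (row_succ_ne N _).symm, Or.inl hrow.symm⟩)
    · exact blackConn_adj hlo (hgap a le_rfl (by omega))
        ((adj_castSucc_last_iff _ _ _).2 ⟨rfl, Or.inr (Or.inl ⟨hrow.symm, hf⟩)⟩)
  -- top attachment
  have htop' : BlackConn ((splitEquiv w L).symm (y, (c, f))) (Fin.last (w + 1), N.row (a + g - 1))
      ((Fin.last w).castSucc, N.row (a + g)) := by
    rcases htop with hc | hf
    · have h1 : BlackConn ((splitEquiv w L).symm (y, (c, f))) (Fin.last (w + 1), N.row (a + g - 1))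
          (Fin.last (w + 1), N.row (a + g)) :=
        blackConn_adj (hgap _ (by omega) (by omega)) (by rw [ext_fst_last]; exact hc)
          ((adj_last_last_iff _ _).2 ⟨by rw [← hrow', ← row_succ]; exact (row_succ_ne N _).symm, Or.inl hrow'.symm⟩)
      exact blackConn_step h1 hhi
        (((adj_castSucc_last_iff _ _ _).2 ⟨rfl, Or.inl rfl⟩).symm)
    · exact blackConn_adj (hgap _ (by omega) (by omega)) hhi
        (((adj_castSucc_last_iff _ _ _).2 ⟨rfl, Or.inr (Or.inr ⟨hrow'.symm, hf⟩)⟩).symm)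
  exact blackConn_trans (blackConn_trans hbot' hmid) htop'

/-- A CHAIN OF LINKS is a black path of the wider slab between any two cells of the end runs. -/
theorem chain_conn {i j : Fin N.k} (h : Relation.ReflTransGen (N.Linked y (N.crossVec c f)) i j) :
    ∀ {o o' : ℕ}, N.InRun i o → N.InRun j o' →
      BlackConn ((splitEquiv w L).symm (y, (c, f))) ((Fin.last w).castSucc, N.row o)
        ((Fin.last w).castSucc, N.row o') := by
  induction h with
  | refl => exact fun ho ho' => run_conn N hcol ho ho'
  | @tail b d _ hbd ih =>
    intro o o' ho ho'
    rcases hbd with ⟨hx, hnext⟩ | ⟨hx, hprev⟩ | ⟨u, hu, v, hv, huv⟩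
    · have h2 := gap_conn N hcol (i := b) hx
      rw [row_gapEnd N b d hnext] at h2
      exact blackConn_trans (blackConn_trans (ih ho (inRun_gapStart_sub_one N b)) h2)
        (run_conn N hcol (inRun_runStart N d) ho')
    · have h2 := blackConn_symm (gap_conn N hcol (i := d) hx)
      rw [row_gapEnd N d b hprev] at h2
      exact blackConn_trans (blackConn_trans (ih ho (inRun_runStart N b)) h2)
        (run_conn N hcol (inRun_gapStart_sub_one N d) ho')
    · obtain ⟨hu1, p, -, hpu, hpr⟩ := hu
      obtain ⟨hv1, q, -, hqv, hqr⟩ := hv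
      have hl := blackConn_lift (c := c) (f := f) huv
      obtain ⟨u1, u2⟩ := u
      obtain ⟨v1, v2⟩ := v
      simp only at hu1 hv1 hpr hqr hl
      subst hu1 hv1 hpr hqr
      exact blackConn_trans (blackConn_trans (ih ho hpu) hl) (run_conn N hcol hqv ho')

/-- "⇐": the link function at the crossing vector forces the arcs event of the wider slab. -/
theorem arcs_of_phi {n : ℕ} (h : N.Phi y n (N.crossVec c f)) :
    (splitEquiv w L).symm (y, (c, f)) ∈ arcsEvent (w + 1) L n := by
  rcases h with ⟨r₁, r₂, h1, h2, h3, h4, hB⟩ | ⟨i, j, ⟨r₁, h1, h2, u, hu, hB1⟩, ⟨r₂, h3, h4, v, hv, hB2⟩, hij⟩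
  · exact ⟨r₁, r₂, h1, h2, h3, h4, by simpa using blackConn_lift (c := c) (f := f) hB⟩
  · obtain ⟨hu1, p, -, hpu, hpr⟩ := hu
    obtain ⟨hv1, q, -, hqv, hqr⟩ := hv
    have hl1 := blackConn_lift (c := c) (f := f) hB1
    have hl2 := blackConn_lift (c := c) (f := f) hB2
    obtain ⟨u1, u2⟩ := u
    obtain ⟨v1, v2⟩ := v
    simp only at hu1 hv1 hpr hqr hl1 hl2
    subst hu1 hv1 hpr hqr
    simp only [Fin.castSucc_zero] at hl1 hl2
    exact ⟨r₁, r₂, h1, h2, h3, h4,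
      blackConn_trans (blackConn_trans hl1 (chain_conn N hcol hij hpu hqv)) (blackConn_symm hl2)⟩

end phiToArcs

end LinkArcsIffStub

/-- **`stub_linkArcsIff`, direction "⇐"** (auxiliary registered statement): the necklace link function at the
crossing vector of the new column forces the arcs event of the wider slab. -/
theorem stub_linkArcsIff_of_phi : ∀ (w L n : ℕ) [NeZero L] (y : CylCfg w L) (N : Necklace L),
    N.col = (fun r => y.1 (Fin.last w, r)) → ∀ c f : ZMod L → Bool,
      N.Phi y n (N.crossVec c f) → (splitEquiv w L).symm (y, (c, f)) ∈ arcsEvent (w + 1) L n :=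
  fun _ _ _ _ _ N hcol _ _ h => LinkArcsIffStub.arcs_of_phi N hcol h

end Summit.CriticalPhenomena.CardyFormulaZ2.Cruxes.IKMixedBoxCrossing.DefectClosureExploration

end
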